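import Mathlib
import Summits.AtomisticToContinuum.Crystallization.Theses.SquareWellLayerCake
import Literature.Geometry.DiscreteGeometry.DelaunaySubdivision
import Literature.Geometry.DiscreteGeometry.SolidAngleFraction
import HarnessLib

/-!
# Line `Sketch` (idea `par-five-delaunay-recount`) of crux `SquareWellLayerCake.AveragedTwelve`
# (stmt-AtomisticToContinuum-15806): the glue `stub_assemble`

From the ghost frame, the solid-angle and dihedral partitions of unity in complex form, Girard in
complex form and the residual par-five/par-six inequality (the other registered stubs of the line,
taken here as HYPOTHESES — this file proves the registered implication `stub_assemble`) to the crux: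
* `recount_comb`: Euler's link identity `#Nb − 12 = Σ_{z ∈ Nb} (t_vz − 5)` at a vertex from the two
  partitions of unity and Girard (pure finite bookkeeping: `T_v = 2·deg v − 4`, `Σ_z t_vz = 3 T_v`);
* `near_pair_mem_faces`: pairs shorter than `√2·d`, all other sites `d`-far from both ends, are Gabriel
  pairs, hence edges of every Delaunay triangulation (tree `pair_mem_of_gabriel` + Apollonius);
* `pointset_bound`: frame the `d`-separated point set, triangulate (tree `exists_isDelaunayTriangulation`),
  recount at every point, identify near Delaunay neighbours with `ρ`-close points, sum;
* `stub_assemble`: the `Fin N`-indexed crux statement reduces to the point set `x(G)` (injective on `G`).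
-/

noncomputable section

open scoped BigOperators Classical

namespace Summit.AtomisticToContinuum.Crystallization.Theorems.ParFiveRecountAssemble

open Literature.Geometry.DiscreteGeometry

/-- **Euler's link identity from two partitions of unity and Girard (abstract form).**
`Sv` = cells at `v` (each contains `v` and has 4 vertices), `Nb ∌ v` contains every other vertex of
every cell of `Sv`; if the solid-angle fractions `saf t` of the cells sum to `1`, the dihedral fractions
`df t z` around each edge `vz` (`z ∈ Nb`) sum to `1`, and Girard `saf t = (Σ_{z ∈ t∖v} df t z)/2 − 1/4`
holds for every cell, then `#Nb − 12 = Σ_{z ∈ Nb} (#cells on vz − 5)`. [folklore] -/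
theorem recount_comb {α : Type*} [DecidableEq α] (Sv : Finset (Finset α)) (Nb : Finset α) (v : α)
    (saf : Finset α → ℝ) (df : Finset α → α → ℝ)
    (hcell : ∀ t ∈ Sv, v ∈ t ∧ t.card = 4) (hNb : ∀ t ∈ Sv, ∀ z ∈ t, z ≠ v → z ∈ Nb) (hvNb : v ∉ Nb)
    (hV : ∑ t ∈ Sv, saf t = 1) (hE : ∀ z ∈ Nb, ∑ t ∈ Sv.filter (fun t => z ∈ t), df t z = 1)
    (hG : ∀ t ∈ Sv, saf t = (∑ z ∈ t.erase v, df t z) / 2 - 1 / 4) :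
    ((Nb.card : ℤ) - 12) = ∑ z ∈ Nb, ((((Sv.filter (fun t => z ∈ t)).card : ℤ)) - 5) := by
  -- (1) swap the double sum: Σ_t Σ_{z ∈ t.erase v} = Σ_{z ∈ Nb} Σ_{t ∈ Sv, z ∈ t}
  have hswap : ∀ (g : Finset α → α → ℝ),
      ∑ t ∈ Sv, ∑ z ∈ t.erase v, g t z = ∑ z ∈ Nb, ∑ t ∈ Sv.filter (fun t => z ∈ t), g t z := by
    intro g
    rw [Finset.sum_comm' (t' := Nb) (s' := fun z => Sv.filter (fun t => z ∈ t))]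
    intro t z
    constructor
    · rintro ⟨ht, hz⟩
      exact ⟨Finset.mem_filter.2 ⟨ht, Finset.mem_of_mem_erase hz⟩,
        hNb t ht z (Finset.mem_of_mem_erase hz) (Finset.ne_of_mem_erase hz)⟩
    · rintro ⟨ht, hz⟩
      rw [Finset.mem_filter] at ht
      refine ⟨ht.1, Finset.mem_erase.2 ⟨?_, ht.2⟩⟩
      rintro rfl
      exact hvNb hz
  have hdf : ∑ t ∈ Sv, ∑ z ∈ t.erase v, df t z = (Nb.card : ℝ) := by
    rw [hswap, Finset.card_eq_sum_ones, Nat.cast_sum]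
    refine Finset.sum_congr rfl fun z hz => ?_
    rw [hE z hz]; simp
  -- (2) T_v = 2 #Nb - 4
  have hT : (Sv.card : ℝ) = 2 * Nb.card - 4 := by
    have h1 : ∑ t ∈ Sv, saf t = (∑ t ∈ Sv, ∑ z ∈ t.erase v, df t z) / 2 - (Sv.card : ℝ) / 4 := by
      rw [Finset.sum_div, Finset.card_eq_sum_ones, Nat.cast_sum, Finset.sum_div, ← Finset.sum_sub_distrib]
      refine Finset.sum_congr rfl fun t ht => ?_
      rw [hG t ht]; push_cast; ring
    rw [hV, hdf] at h1
    linarith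
  -- (3) Σ_z #(cells on vz) = 3 T_v
  have h3 : ∑ z ∈ Nb, (((Sv.filter (fun t => z ∈ t)).card : ℝ)) = 3 * Sv.card := by
    have := hswap (fun _ _ => (1 : ℝ))
    simp only [Finset.sum_const, nsmul_eq_mul, mul_one] at this
    rw [← this]
    rw [Finset.card_eq_sum_ones, Nat.cast_sum, Finset.mul_sum]
    refine Finset.sum_congr rfl fun t ht => ?_
    rw [Finset.card_erase_of_mem (hcell t ht).1, (hcell t ht).2]
    norm_num
  -- (4) conclude over ℤ via ℝ
  have hreal : ((Nb.card : ℝ) - 12) = ∑ z ∈ Nb, ((((Sv.filter (fun t => z ∈ t)).card : ℝ)) - 5) := by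
    rw [Finset.sum_sub_distrib, h3, hT]
    simp only [Finset.sum_const, nsmul_eq_mul]
    ring
  have hcast : (((Nb.card : ℤ) - 12 : ℤ) : ℝ) =
      ((∑ z ∈ Nb, ((((Sv.filter (fun t => z ∈ t)).card : ℤ)) - 5) : ℤ) : ℝ) := by
    push_cast
    exact hreal
  exact_mod_cast hcast

/-- **Pairs shorter than `√2·d` in a set all of whose other points are `d`-far from both ends are
Gabriel pairs, hence edges of every Delaunay triangulation.**  By Apollonius,
`|xm|² = (|xp|² + |xq|²)/2 − |pq|²/4 ≥ d² − |pq|²/4 > |pq|²/4`. [folklore] -/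
theorem near_pair_mem_faces {ω : Set (EuclideanSpace ℝ (Fin 3))}
    {K : Geometry.SimplicialComplex ℝ (EuclideanSpace ℝ (Fin 3))}
    (hK : IsDelaunayTriangulation ω K) {d : ℝ} (hd : 0 ≤ d) {p q : EuclideanSpace ℝ (Fin 3)}
    (hp : p ∈ ω) (hq : q ∈ ω) (hpq : p ≠ q) (hlt : dist p q ^ 2 < 2 * d ^ 2)
    (hsep : ∀ x ∈ ω, x ≠ p → x ≠ q → d ≤ dist x p ∧ d ≤ dist x q) :
    ({p, q} : Finset (EuclideanSpace ℝ (Fin 3))) ∈ K.faces := by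
  refine hK.pair_mem_of_gabriel hp hq hpq fun x hx hxp hxq => ?_
  obtain ⟨h1, h2⟩ := hsep x hx hxp hxq
  have hA := dist_sq_add_dist_sq_eq_midpoint x p q
  have h1' : d ^ 2 ≤ dist x p ^ 2 := pow_le_pow_left₀ hd h1 2
  have h2' : d ^ 2 ≤ dist x q ^ 2 := pow_le_pow_left₀ hd h2 2
  have hm : 0 ≤ dist x (midpoint ℝ p q) := dist_nonneg
  have h3 : dist p q ^ 2 < (2 * dist x (midpoint ℝ p q)) ^ 2 := by nlinarith
  exact lt_of_pow_lt_pow_left₀ 2 (by positivity) h3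

/-- **The crux for point sets, from the five ingredients.** For a `d`-separated finite `P ⊂ ℝ³` and
`ρ ≤ (57/50) d`, granted the ghost frame, the two partitions of unity, Girard and the residual
par-five/par-six inequality, `Σ_{p ∈ P} #{q ∈ P, q ≠ p, |pq| ≤ ρ} ≤ 12 #P`. [folklore] -/
theorem pointset_bound
    (hghost : ∀ (P : Finset (EuclideanSpace ℝ (Fin 3))) (R : ℝ), ∃ Γ : Finset (EuclideanSpace ℝ (Fin 3)), (∀ g ∈ Γ, ∀ p ∈ P, R < dist g p) ∧ ((↑P : Set (EuclideanSpace ℝ (Fin 3))) ⊆ interior (convexHull ℝ (↑(P ∪ Γ) : Set (EuclideanSpace ℝ (Fin 3))))))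
    (hVF : ∀ (ω : Finset (EuclideanSpace ℝ (Fin 3))) (K : Geometry.SimplicialComplex ℝ (EuclideanSpace ℝ (Fin 3))), Literature.Geometry.DiscreteGeometry.IsTriangulation (↑ω : Set (EuclideanSpace ℝ (Fin 3))) K → ∀ v ∈ ω, v ∈ interior (convexHull ℝ (↑ω : Set (EuclideanSpace ℝ (Fin 3)))) → ∀ (S : Finset (Finset (EuclideanSpace ℝ (Fin 3)))), (∀ t, t ∈ S ↔ t ∈ K.faces ∧ v ∈ t ∧ t.card = 4) → ∑ t ∈ S, Literature.Geometry.DiscreteGeometry.ballFraction v (Literature.Geometry.DiscreteGeometry.apexCone v (fun w : ↥((t).erase v) => (↑w : EuclideanSpace ℝ (Fin 3)) - v)) = 1)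
    (hEF : ∀ (ω : Finset (EuclideanSpace ℝ (Fin 3))) (K : Geometry.SimplicialComplex ℝ (EuclideanSpace ℝ (Fin 3))), Literature.Geometry.DiscreteGeometry.IsTriangulation (↑ω : Set (EuclideanSpace ℝ (Fin 3))) K → ∀ v ∈ ω, v ∈ interior (convexHull ℝ (↑ω : Set (EuclideanSpace ℝ (Fin 3)))) → ∀ (z : EuclideanSpace ℝ (Fin 3)), z ≠ v → ({v, z} : Finset (EuclideanSpace ℝ (Fin 3))) ∈ K.faces → ∀ (S : Finset (Finset (EuclideanSpace ℝ (Fin 3)))), (∀ t, t ∈ S ↔ t ∈ K.faces ∧ v ∈ t ∧ z ∈ t ∧ t.card = 4) → ∑ t ∈ S, Literature.Geometry.DiscreteGeometry.ballFraction v (Literature.Geometry.DiscreteGeometry.apexWedge v (z - v) (fun w : ↥(((t).erase v).erase z) => (↑w : EuclideanSpace ℝ (Fin 3)) - v)) = 1)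
    (hGC : ∀ (K : Geometry.SimplicialComplex ℝ (EuclideanSpace ℝ (Fin 3))) (t : Finset (EuclideanSpace ℝ (Fin 3))), t ∈ K.faces → t.card = 4 → ∀ v ∈ t, Literature.Geometry.DiscreteGeometry.ballFraction v (Literature.Geometry.DiscreteGeometry.apexCone v (fun w : ↥((t).erase v) => (↑w : EuclideanSpace ℝ (Fin 3)) - v)) = (∑ z ∈ t.erase v, Literature.Geometry.DiscreteGeometry.ballFraction v (Literature.Geometry.DiscreteGeometry.apexWedge v (z - v) (fun w : ↥(((t).erase v).erase z) => (↑w : EuclideanSpace ℝ (Fin 3)) - v))) / 2 - 1 / 4)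
    (hR : ∀ (d ρ : ℝ), 0 < d → ρ ≤ 57 / 50 * d → ∀ (ω P : Finset (EuclideanSpace ℝ (Fin 3))), P ⊆ ω → (∀ p ∈ P, ∀ q ∈ P, p ≠ q → d ≤ dist p q) → (∀ g ∈ ω, g ∉ P → ∀ p ∈ P, ρ < dist g p ∧ d ≤ dist g p) → (↑P : Set (EuclideanSpace ℝ (Fin 3))) ⊆ interior (convexHull ℝ (↑ω : Set (EuclideanSpace ℝ (Fin 3)))) → ∀ (K : Geometry.SimplicialComplex ℝ (EuclideanSpace ℝ (Fin 3))), Literature.Geometry.DiscreteGeometry.IsDelaunayTriangulation (↑ω : Set (EuclideanSpace ℝ (Fin 3))) K → ∀ (Nb : EuclideanSpace ℝ (Fin 3) → Finset (EuclideanSpace ℝ (Fin 3))), (∀ p ∈ P, ∀ z, z ∈ Nb p ↔ z ≠ p ∧ ({p, z} : Finset (EuclideanSpace ℝ (Fin 3))) ∈ K.faces) → ∀ (S : EuclideanSpace ℝ (Fin 3) → EuclideanSpace ℝ (Fin 3) → Finset (Finset (EuclideanSpace ℝ (Fin 3)))), (∀ p ∈ P, ∀ z ∈ Nb p, ∀ t,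 t ∈ S p z ↔ t ∈ K.faces ∧ p ∈ t ∧ z ∈ t ∧ t.card = 4) → ∑ p ∈ P, ∑ z ∈ Nb p, (((S p z).card : ℤ) - 5 - if ρ < dist p z then 1 else 0) ≤ 0)
    {d ρ : ℝ} (hd : 0 < d) (hρ : ρ ≤ 57 / 50 * d) (P : Finset (EuclideanSpace ℝ (Fin 3)))
    (hsep : ∀ p ∈ P, ∀ q ∈ P, p ≠ q → d ≤ dist p q) :
    (∑ p ∈ P, ((P.filter fun q => q ≠ p ∧ dist p q ≤ ρ).card : ℝ)) ≤ 12 * P.card := by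
  rcases P.eq_empty_or_nonempty with rfl | hPne
  · simp
  -- ghost frame
  obtain ⟨Γ, hΓfar, hPint⟩ := hghost P (max ρ d)
  set ω : Finset (EuclideanSpace ℝ (Fin 3)) := P ∪ Γ with hω
  have hPω : P ⊆ ω := Finset.subset_union_left
  have hghostP : ∀ g ∈ ω, g ∉ P → ∀ p ∈ P, ρ < dist g p ∧ d ≤ dist g p := by
    intro g hg hgP p hp
    have hgΓ : g ∈ Γ := (Finset.mem_union.1 hg).resolve_left hgP
    have h := hΓfar g hgΓ p hp
    exact ⟨lt_of_le_of_lt (le_max_left _ _) h, ((le_max_right _ _).trans h.le)⟩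
  -- the sites affinely span the space
  obtain ⟨p₀, hp₀⟩ := hPne
  have htop : affineSpan ℝ (↑ω : Set (EuclideanSpace ℝ (Fin 3))) = ⊤ :=
    interior_convexHull_nonempty_iff_affineSpan_eq_top.1 ⟨p₀, hPint (Finset.mem_coe.2 hp₀)⟩
  -- a Delaunay triangulation of the framed set
  obtain ⟨K, hK⟩ := exists_isDelaunayTriangulation ω.finite_toSet htop
  have hfin : K.faces.Finite := hK.finite_faces ω.finite_toSet
  -- neighbour sets and cell sets
  set Nb : EuclideanSpace ℝ (Fin 3) → Finset (EuclideanSpace ℝ (Fin 3)) := fun p =>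
    ω.filter fun z => z ≠ p ∧ ({p, z} : Finset (EuclideanSpace ℝ (Fin 3))) ∈ K.faces with hNbdef
  have hNb : ∀ p ∈ P, ∀ z, z ∈ Nb p ↔
      z ≠ p ∧ ({p, z} : Finset (EuclideanSpace ℝ (Fin 3))) ∈ K.faces := by
    intro p _ z
    simp only [hNbdef, Finset.mem_filter]
    constructor
    · exact fun h => h.2
    · intro h
      exact ⟨Finset.mem_coe.1 (hK.mem_of_mem h.2 (by simp)), h⟩
  set S : EuclideanSpace ℝ (Fin 3) → EuclideanSpace ℝ (Fin 3) → Finset (Finset (EuclideanSpace ℝ (Fin 3))) :=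
    fun p z => hfin.toFinset.filter fun t => p ∈ t ∧ z ∈ t ∧ t.card = 4 with hSdef
  have hS : ∀ p ∈ P, ∀ z ∈ Nb p, ∀ t, t ∈ S p z ↔ t ∈ K.faces ∧ p ∈ t ∧ z ∈ t ∧ t.card = 4 := by
    intro p _ z _ t
    simp only [hSdef, Finset.mem_filter, Set.Finite.mem_toFinset]
  -- the residual inequality
  have hres := hR d ρ hd hρ ω P hPω hsep hghostP hPint K hK Nb hNb S hS
  -- recount at each p ∈ P
  have hrec : ∀ p ∈ P, ((Nb p).card : ℤ) - 12 = ∑ z ∈ Nb p, (((S p z).card : ℤ) - 5) := by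
    intro p hp
    have hpω : p ∈ ω := hPω hp
    have hpint : p ∈ interior (convexHull ℝ (↑ω : Set (EuclideanSpace ℝ (Fin 3)))) :=
      hPint (Finset.mem_coe.2 hp)
    set Sv : Finset (Finset (EuclideanSpace ℝ (Fin 3))) :=
      hfin.toFinset.filter fun t => p ∈ t ∧ t.card = 4 with hSvdef
    have hSv : ∀ t, t ∈ Sv ↔ t ∈ K.faces ∧ p ∈ t ∧ t.card = 4 := by
      intro t; simp only [hSvdef, Finset.mem_filter, Set.Finite.mem_toFinset]
    have hfilt : ∀ z ∈ Nb p, Sv.filter (fun t => z ∈ t) = S p z := by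
      intro z hz; ext t; simp only [Finset.mem_filter, hSv, hS p hp z hz]; tauto
    have key := recount_comb Sv (Nb p) p
      (fun t => ballFraction p (apexCone p (fun w : ↥(t.erase p) => (↑w : EuclideanSpace ℝ (Fin 3)) - p)))
      (fun t z => ballFraction p (apexWedge p (z - p)
        (fun w : ↥((t.erase p).erase z) => (↑w : EuclideanSpace ℝ (Fin 3)) - p)))
      (fun t ht => ⟨((hSv t).1 ht).2.1, ((hSv t).1 ht).2.2⟩)
      (by
        intro t ht z hzt hzp
        rw [hNb p hp]
        refine ⟨hzp, K.down_closed ((hSv t).1 ht).1 ?_ (Finset.insert_nonempty _ _)⟩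
        intro w hw
        rcases Finset.mem_insert.1 hw with rfl | hw
        · exact ((hSv t).1 ht).2.1
        · rw [Finset.mem_singleton.1 hw]; exact hzt)
      (by rw [hNb p hp]; exact fun h => h.1 rfl)
      (hVF ω K hK.toIsTriangulation p hpω hpint Sv hSv)
      (by
        intro z hz
        have hz' := (hNb p hp z).1 hz
        refine hEF ω K hK.toIsTriangulation p hpω hpint z hz'.1 hz'.2 (Sv.filter fun t => z ∈ t) ?_
        intro t; simp only [Finset.mem_filter, hSv]; tauto)
      (fun t ht => hGC K t ((hSv t).1 ht).1 ((hSv t).1 ht).2.2 p ((hSv t).1 ht).2.1)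
    rw [key]
    exact Finset.sum_congr rfl fun z hz => by rw [hfilt z hz]
  -- near neighbours in K = ρ-close points of P
  have hnear : ∀ p ∈ P, (Nb p).filter (fun z => ¬ ρ < dist p z) =
      P.filter (fun q => q ≠ p ∧ dist p q ≤ ρ) := by
    intro p hp
    ext z
    simp only [Finset.mem_filter, not_lt]
    constructor
    · rintro ⟨hz, hzρ⟩
      have hz' := (hNb p hp z).1 hz
      have hzω : z ∈ ω := Finset.mem_coe.1 (hK.mem_of_mem hz'.2 (by simp))
      have hzP : z ∈ P := by
        by_contra hzP
        have := (hghostP z hzω hzP p hp).1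
        rw [dist_comm] at this
        linarith
      exact ⟨hzP, hz'.1, hzρ⟩
    · rintro ⟨hzP, hzp, hzρ⟩
      refine ⟨(hNb p hp z).2 ⟨hzp, ?_⟩, hzρ⟩
      have hρ0 : 0 ≤ ρ := dist_nonneg.trans hzρ
      refine near_pair_mem_faces hK hd.le (Finset.mem_coe.2 (hPω hp)) (Finset.mem_coe.2 (hPω hzP))
        (Ne.symm hzp) ?_ ?_
      · have h1 : dist p z ^ 2 ≤ ρ ^ 2 := pow_le_pow_left₀ dist_nonneg hzρ 2
        have h2 : ρ ^ 2 ≤ (57 / 50 * d) ^ 2 := pow_le_pow_left₀ hρ0 hρ 2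
        nlinarith
      · intro x hx hxp hxz
        have hxω : x ∈ ω := Finset.mem_coe.1 hx
        by_cases hxP : x ∈ P
        · exact ⟨hsep x hxP p hp hxp, hsep x hxP z hzP hxz⟩
        · exact ⟨(hghostP x hxω hxP p hp).2, (hghostP x hxω hxP z hzP).2⟩
  -- per-vertex summation
  have hsum : ∀ p ∈ P, ∑ z ∈ Nb p, (((S p z).card : ℤ) - 5 - if ρ < dist p z then 1 else 0)
      = ((P.filter fun q => q ≠ p ∧ dist p q ≤ ρ).card : ℤ) - 12 := by
    intro p hp
    rw [Finset.sum_sub_distrib, ← hrec p hp, ← hnear p hp, Finset.sum_ite, Finset.sum_const_zero,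
      add_zero, Finset.sum_const, nsmul_eq_mul, mul_one]
    have hc := Finset.card_filter_add_card_filter_not (s := Nb p) (fun z => ρ < dist p z)
    have hc' : (((Nb p).filter (fun z => ¬ ρ < dist p z)).card : ℤ) =
        (Nb p).card - ((Nb p).filter (fun z => ρ < dist p z)).card := by
      rw [← hc]; push_cast; ring
    rw [hc']
    ring
  have htot : ∑ p ∈ P, (((P.filter fun q => q ≠ p ∧ dist p q ≤ ρ).card : ℤ) - 12) ≤ 0 := by
    calc ∑ p ∈ P, (((P.filter fun q => q ≠ p ∧ dist p q ≤ ρ).card : ℤ) - 12)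
        = ∑ p ∈ P, ∑ z ∈ Nb p, (((S p z).card : ℤ) - 5 - if ρ < dist p z then 1 else 0) :=
          Finset.sum_congr rfl fun p hp => (hsum p hp).symm
      _ ≤ 0 := hres
  have hZ : ∑ p ∈ P, ((P.filter fun q => q ≠ p ∧ dist p q ≤ ρ).card : ℤ) ≤ 12 * P.card := by
    rw [Finset.sum_sub_distrib, Finset.sum_const, nsmul_eq_mul] at htot
    linarith
  have hR' := (Int.cast_le (R := ℝ)).2 hZ
  push_cast at hR'
  exact hR'


/-- **The registered glue stub `stub_assemble` of line `Sketch`**: ghost frame → solid-angle partition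
of unity → dihedral partition of unity → Girard → residual par-five/par-six inequality → the crux
`SquareWellLayerCake.AveragedTwelve`.  The `Fin N`-indexed configuration restricted to `G` is injective
(`d`-separation, `d > 0`), so everything is read on the point set `P = x(G)` (`pointset_bound`). -/
theorem stub_assemble : (∀ (P : Finset (EuclideanSpace ℝ (Fin 3))) (R : ℝ), ∃ Γ : Finset (EuclideanSpace ℝ (Fin 3)), (∀ g ∈ Γ, ∀ p ∈ P, R < dist g p) ∧ ((↑P : Set (EuclideanSpace ℝ (Fin 3))) ⊆ interior (convexHull ℝ (↑(P ∪ Γ) : Set (EuclideanSpace ℝ (Fin 3)))))) → (∀ (ω : Finset (EuclideanSpace ℝ (Fin 3))) (K : Geometry.SimplicialComplex ℝ (EuclideanSpace ℝ (Fin 3))), Literature.Geometry.DiscreteGeometry.IsTriangulation (↑ω : Set (EuclideanSpace ℝ (Fin 3))) K → ∀ v ∈ ω, v ∈ interior (convexHull ℝ (↑ω : Set (EuclideanSpace ℝ (Fin 3)))) → ∀ (S : Finset (Finset (EuclideanSpace ℝ (Fin 3)))), (∀ t, t ∈ S ↔ t ∈ K.faces ∧ v ∈ t ∧ t.card = 4)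 → ∑ t ∈ S, Literature.Geometry.DiscreteGeometry.ballFraction v (Literature.Geometry.DiscreteGeometry.apexCone v (fun w : ↥((t).erase v) => (↑w : EuclideanSpace ℝ (Fin 3)) - v)) = 1) → (∀ (ω : Finset (EuclideanSpace ℝ (Fin 3))) (K : Geometry.SimplicialComplex ℝ (EuclideanSpace ℝ (Fin 3))), Literature.Geometry.DiscreteGeometry.IsTriangulation (↑ω : Set (EuclideanSpace ℝ (Fin 3))) K → ∀ v ∈ ω, v ∈ interior (convexHull ℝ (↑ω : Set (EuclideanSpace ℝ (Fin 3)))) → ∀ (z : EuclideanSpace ℝ (Fin 3)), z ≠ v → ({v, z} : Finset (EuclideanSpace ℝ (Fin 3))) ∈ K.faces → ∀ (S : Finset (Finset (EuclideanSpace ℝ (Fin 3)))), (∀ t, t ∈ S ↔ t ∈ K.faces ∧ v ∈ t ∧ z ∈ t ∧ t.card = 4) → ∑ t ∈ S, Literature.Geometry.DiscreteGeometry.ballFraction v (Literature.Geometry.DiscreteGeometry.apexWedge v (z - v) (fun w : ↥(((t).erase v).erase z) => (↑w : EuclideanSpace ℝ (Fin 3)) - v)) = 1) → (∀ (K : Geometry.SimplicialComplex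 ℝ (EuclideanSpace ℝ (Fin 3))) (t : Finset (EuclideanSpace ℝ (Fin 3))), t ∈ K.faces → t.card = 4 → ∀ v ∈ t, Literature.Geometry.DiscreteGeometry.ballFraction v (Literature.Geometry.DiscreteGeometry.apexCone v (fun w : ↥((t).erase v) => (↑w : EuclideanSpace ℝ (Fin 3)) - v)) = (∑ z ∈ t.erase v, Literature.Geometry.DiscreteGeometry.ballFraction v (Literature.Geometry.DiscreteGeometry.apexWedge v (z - v) (fun w : ↥(((t).erase v).erase z) => (↑w : EuclideanSpace ℝ (Fin 3)) - v))) / 2 - 1 / 4) → (∀ (d ρ : ℝ), 0 < d → ρ ≤ 57 / 50 * d → ∀ (ω P : Finset (EuclideanSpace ℝ (Fin 3))), P ⊆ ω → (∀ p ∈ P, ∀ q ∈ P, p ≠ q → d ≤ dist p q) → (∀ g ∈ ω, g ∉ P → ∀ p ∈ P, ρ < dist g p ∧ d ≤ dist g p) → (↑P : Set (EuclideanSpace ℝ (Fin 3))) ⊆ interior (convexHull ℝ (↑ω : Set (EuclideanSpace ℝ (Fin 3)))) → ∀ (K : Geometry.SimplicialComplex ℝ (EuclideanSpace ℝ (Fin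 3))), Literature.Geometry.DiscreteGeometry.IsDelaunayTriangulation (↑ω : Set (EuclideanSpace ℝ (Fin 3))) K → ∀ (Nb : EuclideanSpace ℝ (Fin 3) → Finset (EuclideanSpace ℝ (Fin 3))), (∀ p ∈ P, ∀ z, z ∈ Nb p ↔ z ≠ p ∧ ({p, z} : Finset (EuclideanSpace ℝ (Fin 3))) ∈ K.faces) → ∀ (S : EuclideanSpace ℝ (Fin 3) → EuclideanSpace ℝ (Fin 3) → Finset (Finset (EuclideanSpace ℝ (Fin 3)))), (∀ p ∈ P, ∀ z ∈ Nb p, ∀ t, t ∈ S p z ↔ t ∈ K.faces ∧ p ∈ t ∧ z ∈ t ∧ t.card = 4) → ∑ p ∈ P, ∑ z ∈ Nb p, (((S p z).card : ℤ) - 5 - if ρ < dist p z then 1 else 0) ≤ 0) → Summit.AtomisticToContinuum.Crystallization.Theses.SquareWellLayerCake.AveragedTwelve := by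
  intro hghost hVF hEF hGC hR N x G d ρ hd hρ hsep
  -- injectivity on G
  have hinj : Set.InjOn x ↑G := by
    intro i hi j hj hij
    by_contra hne
    have h := hsep i (Finset.mem_coe.1 hi) j (Finset.mem_coe.1 hj) hne
    rw [hij, dist_self] at h
    linarith
  set P : Finset (EuclideanSpace ℝ (Fin 3)) := G.image x with hPdef
  have hcardP : P.card = G.card := Finset.card_image_of_injOn hinj
  have hsepP : ∀ p ∈ P, ∀ q ∈ P, p ≠ q → d ≤ dist p q := by
    intro p hp q hq hpq
    obtain ⟨i, hi, rfl⟩ := Finset.mem_image.1 hp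
    obtain ⟨j, hj, rfl⟩ := Finset.mem_image.1 hq
    exact hsep i hi j hj fun h => hpq (by rw [h])
  have hcount : ∀ i ∈ G, ((P.filter fun q => q ≠ x i ∧ dist (x i) q ≤ ρ).card) =
      (G.filter fun j => j ≠ i ∧ dist (x i) (x j) ≤ ρ).card := by
    intro i hi
    have himg : (G.filter fun j => j ≠ i ∧ dist (x i) (x j) ≤ ρ).image x =
        P.filter fun q => q ≠ x i ∧ dist (x i) q ≤ ρ := by
      rw [hPdef, Finset.filter_image]
      congr 1
      refine Finset.filter_congr fun j hj => ?_
      constructor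
      · rintro ⟨hji, hdist⟩
        exact ⟨fun h => hji (hinj (Finset.mem_coe.2 hj) (Finset.mem_coe.2 hi) h), hdist⟩
      · rintro ⟨hji, hdist⟩
        exact ⟨fun h => hji (by rw [h]), hdist⟩
    rw [← himg, Finset.card_image_of_injOn (hinj.mono (Finset.coe_subset.2 (Finset.filter_subset _ _)))]
  have hsumeq : (∑ i ∈ G, ((G.filter fun j => j ≠ i ∧ dist (x i) (x j) ≤ ρ).card : ℝ)) =
      ∑ p ∈ P, ((P.filter fun q => q ≠ p ∧ dist p q ≤ ρ).card : ℝ) := by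
    rw [hPdef, Finset.sum_image (fun i hi j hj h => hinj (Finset.mem_coe.2 hi) (Finset.mem_coe.2 hj) h)]
    refine Finset.sum_congr rfl fun i hi => ?_
    rw [← hPdef, hcount i hi]
  rw [hsumeq, ← hcardP]
  exact pointset_bound hghost hVF hEF hGC hR hd hρ P hsepP

end Summit.AtomisticToContinuum.Crystallization.Theorems.ParFiveRecountAssemble

end
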